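import Mathlib
import Summits.NavierStokesRegularity.NavierStokesRegularity.Theorems.EulerZoomLiouvillePowerGaugeEulerLiouvilleHoopNetPressureDrop
import Summits.NavierStokesRegularity.NavierStokesRegularity.Theorems.EulerZoomLiouvillePowerGaugeEulerLiouvilleHoopRidgeRunEnergyTools
import HarnessLib

/-!
# R51 plate t54-LAW-CORE: THE RIDGE-RUN ENERGY LAW, CORE (axis coordinates, general centre)
# (nsreg-p2 ROUND-51 v1.2/v1.3 §2/§7, `RidgeRunEnergyCore` text VERBATIM from `r51/TJlawcore_Q.lean` b71ada25c423c2ac l.42; key nsreg-p2 g41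
# 05:02:22Z → seat ns-sfl-p1 g8; `--supports stmt-NavierStokesRegularity-19832 --as helper`)

★ `HoopCore.ridgeRunEnergyCore : RidgeRunEnergyCore` — for a self-similar profile `(γ, c, V, P)` with `0 < γ < 1` satisfying the CAP COST
bounds (`hCC`, = `NsregP2.R51.CapCostBound` at `(γ,c,V)`, t54-CC, a HYPOTHESIS here): for all `Λ, μ, ν` with `8ν² + 14γν < Λμ` there are
`ε₀ > 0`, `R₁` such that every `e_Z`-axis cylinder `solidCyl s₁ s₂ T₀` with `R ≥ R₁`, `R ≥ 1`, `0 < T₀ ≤ 1`, `s₂ − s₁ ≥ ΛT₀`, `cylRadius c ≤ 2R`,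
`|σ − c₂| ≤ 2R`, the lateral hoop inequality on every sub-cylinder (`hlat`, = t53-LEL, a HYPOTHESIS here), the ridge `μR² ≤ P(σe_Z) − ⟨P⟩_θ(σ,T₀)`
and the wall speed `‖V‖ ≤ νR` on `[s₁, s₂]` carries `ε₀R²(s₂ − s₁) ≤ ∫_{solidCyl s₁ s₂ T₀} |DV|_F²`.

PROOF (the planner's bookkeeping, made kernel): suppose `E := ∫_Z|DV|_F² < ε₀R²L`, `L = s₂ − s₁`.  Two CUTS `σ₁ ∈ [s₁, s₁+θL]`,
`σ₂ ∈ [s₂−θL, s₂]` by `HoopCore.cutSelection` (p697270) have disc energy `Dᵢ ≤ E/(θL) ≤ ε₀R²/θ ≤ πr²R²`; the NET LAW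
`HoopCore.integral_axisPressureDrop_le_of_lateral` (p695911, ns-ezl-w3 g7) on `[σ₁, σ₂]` with `hlat`, the ridge (`LHS ≥ 2πμR²(1−2θ)L`) and `hCC` at
`σ₁, σ₂` with `w = νR` (`√(2w² + D/π) ≤ (√2ν + r)R`, `√(2(γ|σ−c₂|+w)² + D/π) ≤ (√2(2γ+ν) + r)R`) give, after division by `2πR²T₀`,
`Λ(μ(1−2θ) − ε₀/π) ≤ 8ν² + (8+4√2)γν + 4r² + (4√2(γ+ν)+4γ)r + 6(√2ν+r)/R`; with the slack `sl = Λμ − (8ν²+14γν) > 0` the choices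
`θ = min(¼, sl/(8Λμ))`, `r = min(1, sl/(4(4+K)))`, `ε₀ = min(πθr², πsl/(8Λ))`, `R₁ = 48(√2ν+r)/sl + 1` make this `Λμ − 3sl/8 ≤ Λμ − 5sl/8`, absurd.

HONEST FRAMING: class-free bookkeeping (no E-TAIL, no (E), no budgets) for HYPOTHETICAL profiles, with t54-CC and t53-LEL as hypotheses by shape;
an instrument for the ridge member / dust endgame of ROUND-51; nothing about the crux E (19832 OPEN) or NS regularity is proved here.
[nsreg-p2 R51 §2; folklore]
-/

noncomputable section

set_option linter.dupNamespace false

open MeasureTheory Set Filter Topology Metric Function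
open scoped RealInnerProductSpace Topology Interval

namespace Summit.NavierStokesRegularity.NavierStokesRegularity.Theorems.PowerGaugeEulerLiouville

open Literature.Analysis Literature.Analysis.FluidPDE

namespace HoopCore

/-! ## The core theorem -/

set_option maxHeartbeats 400000 in
/-- **RIDGE-RUN ENERGY LAW, CORE** (`RidgeRunEnergyCore` of nsreg-p2 `r51/TJlawcore_Q.lean` b71ada25c423c2ac VERBATIM, axis coordinates,
centre `c`; t54-LAW-CORE): for a self-similar profile `(γ, c, V, P)`, `0 < γ < 1`, with the CAP COST bounds `hCC` (= `NsregP2.R51.CapCostBound` at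
`(γ,c,V)`, hypothesis): for all `Λ, μ, ν` with `8ν² + 14γν < Λμ` there are `ε₀ > 0`, `R₁` such that every cylinder `solidCyl s₁ s₂ T₀` with
`R ≥ R₁`, `R ≥ 1`, `0 < T₀ ≤ 1`, `s₂ − s₁ ≥ ΛT₀`, `cylRadius c ≤ 2R`, `|σ − c₂| ≤ 2R` on `[s₁,s₂]`, the lateral hoop inequality on every
sub-cylinder (`hlat`, = t53-LEL, hypothesis), the ridge `μR² ≤ P(σe_Z) − ⟨P⟩_θ(σ,T₀)` and the wall speed `‖V‖ ≤ νR` on `[s₁,s₂]` satisfies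
`ε₀R²(s₂ − s₁) ≤ ∫_{solidCyl s₁ s₂ T₀} |DV|_F²`.  Two cuts (`cutSelection`) + the NET law (`integral_axisPressureDrop_le_of_lateral`) + `hCC`,
bookkeeping as in the module docstring. [nsreg-p2 R51 §2; folklore] -/
theorem ridgeRunEnergyCore :
    ∀ (γ : ℝ) (c : EuclideanSpace ℝ (Fin 3)) (V : EuclideanSpace ℝ (Fin 3) → EuclideanSpace ℝ (Fin 3)) (P : EuclideanSpace ℝ (Fin 3) → ℝ),
    IsSelfSimilarEulerProfile γ c V P → 0 < γ → γ < 1 →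
    (∀ σ T₀ w : ℝ, 0 < T₀ → 0 ≤ w → (∀ θ : ℝ, ‖V (HoopCore.axisPt σ T₀ θ)‖ ≤ w) →
        HoopCore.endFlux V σ T₀
            ≤ 4 * Real.pi * T₀ * w ^ 2
              + 2 * T₀ * (∫ z in closedBall (0 : EuclideanSpace ℝ (Fin 2)) T₀, frobeniusNormSq (fderiv ℝ V (HoopCore.liftAt σ z))) ∧
        |HoopCore.endTermC γ c V T₀ σ|
            ≤ T₀ * Real.sqrt (2 * (|γ| * |σ - c 2| + w) ^ 2
                    + (∫ z in closedBall (0 : EuclideanSpace ℝ (Fin 2)) T₀, frobeniusNormSq (fderiv ℝ V (HoopCore.liftAt σ z))) / Real.pi)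
                * Real.sqrt (2 * w ^ 2
                    + (∫ z in closedBall (0 : EuclideanSpace ℝ (Fin 2)) T₀, frobeniusNormSq (fderiv ℝ V (HoopCore.liftAt σ z))) / Real.pi) ∧
        |HoopCore.offsetTerm γ c V T₀ σ|
            ≤ |γ| * cylRadius c * T₀ * Real.sqrt (2 * w ^ 2
                    + (∫ z in closedBall (0 : EuclideanSpace ℝ (Fin 2)) T₀, frobeniusNormSq (fderiv ℝ V (HoopCore.liftAt σ z))) / Real.pi) ∧
        |∫ t in (0 : ℝ)..T₀, t * HoopCore.circleAvg (axialVelocity V) σ t|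
            ≤ T₀ ^ 2 / Real.sqrt 3 * Real.sqrt (2 * w ^ 2
                    + (∫ z in closedBall (0 : EuclideanSpace ℝ (Fin 2)) T₀, frobeniusNormSq (fderiv ℝ V (HoopCore.liftAt σ z))) / Real.pi) ∧
        (∀ t ∈ Ioc 0 T₀,
            |∫ τ in (0 : ℝ)..t, τ * HoopCore.circleAvg (axialVelocity V) σ τ|
              ≤ t * Real.sqrt t * Real.sqrt (T₀ / 3) * Real.sqrt (2 * w ^ 2
                    + (∫ z in closedBall (0 : EuclideanSpace ℝ (Fin 2)) T₀, frobeniusNormSq (fderiv ℝ V (HoopCore.liftAt σ z))) / Real.pi))) →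
    ∀ Λ μ ν : ℝ, 0 < Λ → 0 < μ → 0 ≤ ν → 8 * ν ^ 2 + 14 * γ * ν < Λ * μ →
      ∃ ε₀ : ℝ, 0 < ε₀ ∧ ∃ R₁ : ℝ, ∀ (R s₁ s₂ T₀ : ℝ),
        R₁ ≤ R → 1 ≤ R → 0 < T₀ → T₀ ≤ 1 → s₁ + Λ * T₀ ≤ s₂ →
        cylRadius c ≤ 2 * R → (∀ σ ∈ Icc s₁ s₂, |σ - c 2| ≤ 2 * R) →
        (∀ σ₁ σ₂ : ℝ, s₁ ≤ σ₁ → σ₁ < σ₂ → σ₂ ≤ s₂ →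
            (∫ y in HoopCore.solidCyl σ₁ σ₂ T₀, HoopCore.hoopDensity V y)
                + 2 * Real.pi * (∫ σ in σ₁..σ₂, HoopCore.circleAvg (fun y => radialVelocity V y ^ 2) σ T₀)
              ≤ 2 * (∫ y in HoopCore.solidCyl σ₁ σ₂ T₀, frobeniusNormSq (fderiv ℝ V y))
                + Real.pi * (∫ σ in σ₁..σ₂, (‖V (σ • eZ)‖ ^ 2 - (axialVelocity V (σ • eZ)) ^ 2))
                + HoopCore.endFlux V σ₁ T₀ + HoopCore.endFlux V σ₂ T₀) →
        (∀ σ ∈ Icc s₁ s₂,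
            μ * R ^ 2 ≤ P (σ • eZ) - HoopCore.circleAvg P σ T₀ ∧
            ∀ θ : ℝ, ‖V (HoopCore.axisPt σ T₀ θ)‖ ≤ ν * R) →
          ε₀ * R ^ 2 * (s₂ - s₁) ≤ ∫ y in HoopCore.solidCyl s₁ s₂ T₀, frobeniusNormSq (fderiv ℝ V y) := by
  intro γ c V P hprof hγ0 hγ1 hCC Λ μ ν hΛ hμ hν hslack
  have hπ := Real.pi_pos
  have hV1 : ContDiff ℝ 1 V := hprof.contDiff_velocity.of_le (by norm_num)
  have hPc : Continuous P := hprof.contDiff_pressure.continuous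
  -- the constants
  set s : ℝ := Real.sqrt 2 with hsdef
  have hs0 : 0 ≤ s := Real.sqrt_nonneg _
  have hs2 : s * s = 2 := Real.mul_self_sqrt (by norm_num)
  have hs32 : s ≤ 3 / 2 := by
    rw [hsdef, Real.sqrt_le_left (by norm_num)]; norm_num
  set sl : ℝ := Λ * μ - (8 * ν ^ 2 + 14 * γ * ν) with hsldef
  have hsl : 0 < sl := by simp only [hsldef]; linarith
  have hΛμ : 0 < Λ * μ := mul_pos hΛ hμ
  set θ : ℝ := min (1 / 4) (sl / (8 * (Λ * μ))) with hθdef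
  have hθ0 : 0 < θ := lt_min (by norm_num) (by positivity)
  have hθ4 : θ ≤ 1 / 4 := min_le_left _ _
  have hθsl : 2 * θ * (Λ * μ) ≤ sl / 4 := by
    have h : θ ≤ sl / (8 * (Λ * μ)) := min_le_right _ _
    rw [le_div_iff₀ (by positivity)] at h
    linarith
  set K : ℝ := 4 * s * (γ + ν) + 4 * γ with hKdef
  have hK0 : 0 ≤ K := by positivity
  set r : ℝ := min 1 (sl / (4 * (4 + K))) with hrdef
  have hr0 : 0 < r := lt_min one_pos (by positivity)
  have hr1 : r ≤ 1 := min_le_left _ _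
  have hrK : (4 + K) * r ≤ sl / 4 := by
    have h : r ≤ sl / (4 * (4 + K)) := min_le_right _ _
    rw [le_div_iff₀ (by positivity)] at h
    linarith
  set ε₀ : ℝ := min (Real.pi * θ * r ^ 2) (Real.pi * sl / (8 * Λ)) with hε₀def
  have hε₀ : 0 < ε₀ := lt_min (by positivity) (by positivity)
  have hε₀d : ε₀ ≤ Real.pi * θ * r ^ 2 := min_le_left _ _
  have hε₀Λ : ε₀ * Λ / Real.pi ≤ sl / 8 := by
    have h : ε₀ ≤ Real.pi * sl / (8 * Λ) := min_le_right _ _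
    rw [div_le_iff₀ hπ]
    rw [le_div_iff₀ (by positivity)] at h
    linarith
  refine ⟨ε₀, hε₀, 48 * (s * ν + r) / sl + 1, ?_⟩
  intro R s₁ s₂ T₀ hR₁ hR1 hT₀ hT₁ hL hcyl hc2 hlat hridge
  have hR0 : 0 < R := by linarith
  have hRQ : 6 * (s * ν + r) ≤ sl / 8 * R := by
    have h1 : 48 * (s * ν + r) / sl ≤ R := by linarith
    rw [div_le_iff₀ hsl] at h1
    linarith
  set L : ℝ := s₂ - s₁ with hLdef
  have hLΛ : Λ * T₀ ≤ L := by simp only [hLdef]; linarith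
  have hL0 : 0 < L := lt_of_lt_of_le (by positivity) hLΛ
  set E : ℝ := ∫ y in solidCyl s₁ s₂ T₀, frobeniusNormSq (fderiv ℝ V y) with hEdef
  have hE0 : 0 ≤ E := setIntegral_nonneg (measurableSet_solidCyl s₁ s₂ T₀) fun y _ => frobeniusNormSq_nonneg _
  by_contra hcon
  push Not at hcon
  -- hcon : E < ε₀ * R ^ 2 * L
  -- the two cuts
  set ℓ : ℝ := θ * L with hℓdef
  have hℓ0 : 0 < ℓ := mul_pos hθ0 hL0
  have hℓL : 2 * ℓ ≤ L / 2 := by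
    have : θ * L ≤ 1 / 4 * L := mul_le_mul_of_nonneg_right hθ4 hL0.le
    simp only [hℓdef]; linarith
  have hLe : L = s₂ - s₁ := rfl
  obtain ⟨σ₁, hσ₁, hD₁⟩ := exists_cut_le hV1 (s₁ := s₁) (s₂ := s₂) (a := s₁) (T₀ := T₀) le_rfl hℓ0
    (by linarith) hT₀
  obtain ⟨σ₂, hσ₂, hD₂⟩ := exists_cut_le hV1 (s₁ := s₁) (s₂ := s₂) (a := s₂ - ℓ) (T₀ := T₀)
    (by linarith) hℓ0 (by linarith) hT₀
  set D₁ : ℝ := ∫ z in closedBall (0 : EuclideanSpace ℝ (Fin 2)) T₀, frobeniusNormSq (fderiv ℝ V (liftAt σ₁ z)) with hD₁def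
  set D₂ : ℝ := ∫ z in closedBall (0 : EuclideanSpace ℝ (Fin 2)) T₀, frobeniusNormSq (fderiv ℝ V (liftAt σ₂ z)) with hD₂def
  have hD₁0 : 0 ≤ D₁ := setIntegral_nonneg measurableSet_closedBall fun z _ => frobeniusNormSq_nonneg _
  have hD₂0 : 0 ≤ D₂ := setIntegral_nonneg measurableSet_closedBall fun z _ => frobeniusNormSq_nonneg _
  have hs₁σ₁ : s₁ ≤ σ₁ := hσ₁.1
  have hσ₂s₂ : σ₂ ≤ s₂ := by linarith [hσ₂.2]
  have hσ₁₂ : (1 - 2 * θ) * L ≤ σ₂ - σ₁ := by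
    have h1 : σ₁ ≤ s₁ + ℓ := hσ₁.2
    have h2 : s₂ - ℓ ≤ σ₂ := hσ₂.1
    have e : (1 - 2 * θ) * L = (s₂ - s₁) - 2 * ℓ := by simp only [hℓdef, hLe]; ring
    rw [e]; linarith
  have hσlt : σ₁ < σ₂ := by
    have h : 0 < (1 - 2 * θ) * L := mul_pos (by linarith) hL0
    linarith
  have hσ₁I : σ₁ ∈ Icc s₁ s₂ := ⟨hs₁σ₁, hσlt.le.trans hσ₂s₂⟩
  have hσ₂I : σ₂ ∈ Icc s₁ s₂ := ⟨hs₁σ₁.trans hσlt.le, hσ₂s₂⟩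
  -- disc energies at the cuts: `Dᵢ ≤ E/ℓ ≤ π r² R²`
  have hEℓ : 1 / ℓ * E ≤ Real.pi * r ^ 2 * R ^ 2 := by
    have h1 : 1 / ℓ * E ≤ 1 / ℓ * (ε₀ * R ^ 2 * L) := mul_le_mul_of_nonneg_left hcon.le (by positivity)
    have h2 : 1 / ℓ * (ε₀ * R ^ 2 * L) = ε₀ / θ * R ^ 2 := by
      simp only [hℓdef]; field_simp
    have h3 : ε₀ / θ ≤ Real.pi * r ^ 2 := by rw [div_le_iff₀ hθ0]; linarith
    rw [h2] at h1
    exact h1.trans (mul_le_mul_of_nonneg_right h3 (sq_nonneg R))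
  have hD₁b : D₁ ≤ Real.pi * r ^ 2 * R ^ 2 := hD₁.trans hEℓ
  have hD₂b : D₂ ≤ Real.pi * r ^ 2 * R ^ 2 := hD₂.trans hEℓ
  -- the NET law on `[σ₁, σ₂]`
  have hNET := integral_axisPressureDrop_le_of_lateral hprof hσlt hT₀ (hlat σ₁ σ₂ hs₁σ₁ hσlt hσ₂s₂)
  -- the ridge
  have hLHS : μ * R ^ 2 * (σ₂ - σ₁) ≤ ∫ σ in σ₁..σ₂, (P (σ • eZ) - circleAvg P σ T₀) :=
    mul_le_integral_axisPressureDrop hPc hσlt.le fun σ hσ => (hridge σ ⟨hs₁σ₁.trans hσ.1, hσ.2.trans hσ₂s₂⟩).1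
  -- the energy of the sub-cylinder
  have hEsub : ∫ y in solidCyl σ₁ σ₂ T₀, frobeniusNormSq (fderiv ℝ V y) ≤ E :=
    setIntegral_frobeniusNormSq_solidCyl_mono hV1 hs₁σ₁ hσ₂s₂ T₀
  -- the cap costs at the two cuts, `w = νR`
  have hνR : 0 ≤ ν * R := by positivity
  obtain ⟨hF₁, hC₁, hO₁, hM₁, hMt₁⟩ := hCC σ₁ T₀ (ν * R) hT₀ hνR fun θ' => (hridge σ₁ hσ₁I).2 θ'
  obtain ⟨hF₂, hC₂, hO₂, hM₂, hMt₂⟩ := hCC σ₂ T₀ (ν * R) hT₀ hνR fun θ' => (hridge σ₂ hσ₂I).2 θ'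
  -- the square roots
  set Sb : ℝ := (s * ν + r) * R with hSbdef
  set Cb : ℝ := (s * (2 * γ + ν) + r) * R with hCbdef
  have hSb0 : 0 ≤ Sb := by positivity
  have hCb0 : 0 ≤ Cb := by positivity
  have hS₁ : Real.sqrt (2 * (ν * R) ^ 2 + D₁ / Real.pi) ≤ Sb := by
    have h := sqrt_capCost_le hνR hD₁0 hD₁b hr0.le hR0.le
    simp only [hSbdef, hsdef]; linarith
  have hS₂ : Real.sqrt (2 * (ν * R) ^ 2 + D₂ / Real.pi) ≤ Sb := by
    have h := sqrt_capCost_le hνR hD₂0 hD₂b hr0.le hR0.le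
    simp only [hSbdef, hsdef]; linarith
  have hγabs : |γ| = γ := abs_of_pos hγ0
  have hCaux : ∀ σ ∈ Icc s₁ s₂, ∀ D : ℝ, 0 ≤ D → D ≤ Real.pi * r ^ 2 * R ^ 2 →
      Real.sqrt (2 * (|γ| * |σ - c 2| + ν * R) ^ 2 + D / Real.pi) ≤ Cb := by
    intro σ hσ D hD0 hD
    have hw : 0 ≤ |γ| * |σ - c 2| + ν * R := by positivity
    have h := sqrt_capCost_le hw hD0 hD hr0.le hR0.le
    have h2 : |γ| * |σ - c 2| ≤ γ * (2 * R) := by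
      rw [hγabs]; exact mul_le_mul_of_nonneg_left (hc2 σ hσ) hγ0.le
    have h3 : Real.sqrt 2 * (|γ| * |σ - c 2| + ν * R) ≤ Real.sqrt 2 * (γ * (2 * R) + ν * R) :=
      mul_le_mul_of_nonneg_left (by linarith) (Real.sqrt_nonneg _)
    simp only [hCbdef, hsdef]
    linarith [h, h3]
  have hCC₁ := hCaux σ₁ hσ₁I D₁ hD₁0 hD₁b
  have hCC₂ := hCaux σ₂ hσ₂I D₂ hD₂0 hD₂b
  -- term by term
  have hEF : endFlux V σ₁ T₀ + endFlux V σ₂ T₀ ≤ 8 * Real.pi * T₀ * ν ^ 2 * R ^ 2 + 4 * Real.pi * T₀ * r ^ 2 * R ^ 2 := by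
    have h1 : 2 * T₀ * D₁ ≤ 2 * T₀ * (Real.pi * r ^ 2 * R ^ 2) := mul_le_mul_of_nonneg_left hD₁b (by positivity)
    have h2 : 2 * T₀ * D₂ ≤ 2 * T₀ * (Real.pi * r ^ 2 * R ^ 2) := mul_le_mul_of_nonneg_left hD₂b (by positivity)
    linarith [hF₁, hF₂, h1, h2]
  have hET : |endTermC γ c V T₀ σ₁| + |endTermC γ c V T₀ σ₂| ≤ 2 * T₀ * Cb * Sb := by
    have h1 : T₀ * Real.sqrt (2 * (|γ| * |σ₁ - c 2| + ν * R) ^ 2 + D₁ / Real.pi) * Real.sqrt (2 * (ν * R) ^ 2 + D₁ / Real.pi)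
        ≤ T₀ * Cb * Sb := by
      rw [mul_assoc, mul_assoc]
      exact mul_le_mul_of_nonneg_left (mul_le_mul hCC₁ hS₁ (Real.sqrt_nonneg _) hCb0) hT₀.le
    have h2 : T₀ * Real.sqrt (2 * (|γ| * |σ₂ - c 2| + ν * R) ^ 2 + D₂ / Real.pi) * Real.sqrt (2 * (ν * R) ^ 2 + D₂ / Real.pi)
        ≤ T₀ * Cb * Sb := by
      rw [mul_assoc, mul_assoc]
      exact mul_le_mul_of_nonneg_left (mul_le_mul hCC₂ hS₂ (Real.sqrt_nonneg _) hCb0) hT₀.le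
    linarith [hC₁.trans h1, hC₂.trans h2]
  have hOT : |offsetTerm γ c V T₀ σ₁| + |offsetTerm γ c V T₀ σ₂| ≤ 4 * γ * R * T₀ * Sb := by
    have hk : |γ| * cylRadius c * T₀ ≤ γ * (2 * R) * T₀ := by
      rw [hγabs]; exact mul_le_mul_of_nonneg_right (mul_le_mul_of_nonneg_left hcyl hγ0.le) hT₀.le
    have hk0 : 0 ≤ |γ| * cylRadius c * T₀ := by rw [hγabs]; exact mul_nonneg (mul_nonneg hγ0.le (cylRadius_nonneg c)) hT₀.le
    have h1 : |γ| * cylRadius c * T₀ * Real.sqrt (2 * (ν * R) ^ 2 + D₁ / Real.pi) ≤ γ * (2 * R) * T₀ * Sb :=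
      mul_le_mul hk hS₁ (Real.sqrt_nonneg _) (by positivity)
    have h2 : |γ| * cylRadius c * T₀ * Real.sqrt (2 * (ν * R) ^ 2 + D₂ / Real.pi) ≤ γ * (2 * R) * T₀ * Sb :=
      mul_le_mul hk hS₂ (Real.sqrt_nonneg _) (by positivity)
    linarith [hO₁.trans h1, hO₂.trans h2]
  have h3 : (1 : ℝ) ≤ Real.sqrt 3 := by
    rw [show (1 : ℝ) = Real.sqrt 1 by simp]; exact Real.sqrt_le_sqrt (by norm_num)
  have hDM : |∫ t in (0 : ℝ)..T₀, t * circleAvg (axialVelocity V) σ₁ t|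
      + |∫ t in (0 : ℝ)..T₀, t * circleAvg (axialVelocity V) σ₂ t| ≤ 2 * T₀ ^ 2 * Sb := by
    have hk : T₀ ^ 2 / Real.sqrt 3 ≤ T₀ ^ 2 := div_le_self (sq_nonneg _) h3
    have h1 : T₀ ^ 2 / Real.sqrt 3 * Real.sqrt (2 * (ν * R) ^ 2 + D₁ / Real.pi) ≤ T₀ ^ 2 * Sb :=
      mul_le_mul hk hS₁ (Real.sqrt_nonneg _) (sq_nonneg _)
    have h2 : T₀ ^ 2 / Real.sqrt 3 * Real.sqrt (2 * (ν * R) ^ 2 + D₂ / Real.pi) ≤ T₀ ^ 2 * Sb :=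
      mul_le_mul hk hS₂ (Real.sqrt_nonneg _) (sq_nonneg _)
    linarith [hM₁.trans h1, hM₂.trans h2]
  have hDQ : |∫ t in (0 : ℝ)..T₀, ((∫ τ in (0 : ℝ)..t, τ * circleAvg (axialVelocity V) σ₁ τ)
      - (∫ τ in (0 : ℝ)..t, τ * circleAvg (axialVelocity V) σ₂ τ)) / t| ≤ 2 * T₀ ^ 2 * Sb :=
    abs_integral_discMass_div_le hT₀ hMt₁ hMt₂ hS₁ hS₂ (Real.sqrt_nonneg _) (Real.sqrt_nonneg _)
  -- the NET law, every term bounded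
  have hγ3 : |1 - 3 * γ| ≤ 2 := by rw [abs_le]; constructor <;> linarith
  have hMAIN : 2 * Real.pi * (μ * R ^ 2 * ((1 - 2 * θ) * L))
      ≤ 2 * E + (8 * Real.pi * T₀ * ν ^ 2 * R ^ 2 + 4 * Real.pi * T₀ * r ^ 2 * R ^ 2)
        + 2 * Real.pi * γ * (2 * T₀ ^ 2 * Sb) + 2 * Real.pi * 2 * (2 * T₀ ^ 2 * Sb)
        + 2 * Real.pi * (2 * T₀ * Cb * Sb) + 2 * Real.pi * (4 * γ * R * T₀ * Sb) := by
    have hl : 2 * Real.pi * (μ * R ^ 2 * ((1 - 2 * θ) * L)) ≤ 2 * Real.pi * (∫ σ in σ₁..σ₂, (P (σ • eZ) - circleAvg P σ T₀)) := by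
      refine mul_le_mul_of_nonneg_left (le_trans ?_ hLHS) (by positivity)
      exact mul_le_mul_of_nonneg_left hσ₁₂ (by positivity)
    refine hl.trans (hNET.trans ?_)
    have t1 : 2 * Real.pi * γ * ((∫ t in (0 : ℝ)..T₀, t * circleAvg (axialVelocity V) σ₁ t)
        - (∫ t in (0 : ℝ)..T₀, t * circleAvg (axialVelocity V) σ₂ t)) ≤ 2 * Real.pi * γ * (2 * T₀ ^ 2 * Sb) := by
      refine mul_le_mul_of_nonneg_left (le_trans ?_ hDM) (by positivity)
      exact (le_abs_self _).trans (abs_sub _ _)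
    have t2 : 2 * Real.pi * (1 - 3 * γ) * (∫ t in (0 : ℝ)..T₀, ((∫ τ in (0 : ℝ)..t, τ * circleAvg (axialVelocity V) σ₁ τ)
        - (∫ τ in (0 : ℝ)..t, τ * circleAvg (axialVelocity V) σ₂ τ)) / t) ≤ 2 * Real.pi * 2 * (2 * T₀ ^ 2 * Sb) := by
      have h := abs_mul (1 - 3 * γ) (∫ t in (0 : ℝ)..T₀, ((∫ τ in (0 : ℝ)..t, τ * circleAvg (axialVelocity V) σ₁ τ)
        - (∫ τ in (0 : ℝ)..t, τ * circleAvg (axialVelocity V) σ₂ τ)) / t)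
      have h1 : |1 - 3 * γ| * |∫ t in (0 : ℝ)..T₀, ((∫ τ in (0 : ℝ)..t, τ * circleAvg (axialVelocity V) σ₁ τ)
          - (∫ τ in (0 : ℝ)..t, τ * circleAvg (axialVelocity V) σ₂ τ)) / t| ≤ 2 * (2 * T₀ ^ 2 * Sb) :=
        mul_le_mul hγ3 hDQ (abs_nonneg _) (by norm_num)
      have h2 := le_abs_self ((1 - 3 * γ) * (∫ t in (0 : ℝ)..T₀, ((∫ τ in (0 : ℝ)..t, τ * circleAvg (axialVelocity V) σ₁ τ)
        - (∫ τ in (0 : ℝ)..t, τ * circleAvg (axialVelocity V) σ₂ τ)) / t))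
      rw [h] at h2
      have h4 := mul_le_mul_of_nonneg_left (h2.trans h1) (le_of_lt (by positivity : (0 : ℝ) < 2 * Real.pi))
      linarith [h4]
    have t3 : 2 * Real.pi * (endTermC γ c V T₀ σ₂ - endTermC γ c V T₀ σ₁) ≤ 2 * Real.pi * (2 * T₀ * Cb * Sb) := by
      refine mul_le_mul_of_nonneg_left (le_trans ?_ hET) (by positivity)
      linarith [le_abs_self (endTermC γ c V T₀ σ₂), neg_abs_le (endTermC γ c V T₀ σ₁)]
    have t4 : -(2 * Real.pi * (offsetTerm γ c V T₀ σ₂ - offsetTerm γ c V T₀ σ₁)) ≤ 2 * Real.pi * (4 * γ * R * T₀ * Sb) := by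
      rw [← mul_neg]
      refine mul_le_mul_of_nonneg_left (le_trans ?_ hOT) (by positivity)
      linarith [le_abs_self (offsetTerm γ c V T₀ σ₁), neg_abs_le (offsetTerm γ c V T₀ σ₂)]
    linarith [hEsub, hEF, t1, t2, t3, t4]
  -- bookkeeping ÷ `2πR²T₀` (`…HoopRidgeRunEnergyTools.ridgeRun_bookkeeping`)
  exact ridgeRun_bookkeeping hs2 hs32 hs0 hγ0 hγ1 hν hΛ hμ rfl hsl hθ4 hθsl rfl hr0 hr1 hrK hε₀Λ hR0 hRQ hT₀ hT₁ hLΛ hcon hMAIN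

end HoopCore

end Summit.NavierStokesRegularity.NavierStokesRegularity.Theorems.PowerGaugeEulerLiouville

end
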